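import Literature.MathematicalPhysics.QuantumLattice.LiebWuFiniteBNeumannSeries
import Literature.MathematicalPhysics.QuantumLattice.LiebWuIntegralEquationsUniqueness
import HarnessLib

/-!
# Lieb–Wu 2003, Theorem 1: uniqueness of the solution of (13)–(14) for every rapidity range `0 < B ≤ ∞`

Family `hubbard`. Lieb–Wu, PRL 20 (1968) 1445, statement (a) ("unique … for all allowed `B` and `Q`");
Physica A 321 (2003) 1, §5, THEOREM 1 (Uniqueness). `LiebWuIntegralEquationsUniqueness` proved the case
`B = ∞`; this file proves it for an arbitrary measurable rapidity range `SΛ` (printed case `[-B, B]`):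
two `L¹` solutions of (13)–(14) with the same `(U, Q, SΛ)` have THE SAME `σ` ON `SΛ` (pointwise);
the consequences for `ρ`, (15)–(17) are drawn in the monotonicity file. Printed argument, for a general
range: with `δ = 1_{SΛ}(σ₁ - σ₂)`, `G = δ ∗ K`, `AG = 1_{(-a,a]}G` (`a = sin Q`, `x = sin k`), (13)–(14) give
`δ = E` on `SΛ`, `E := AG ∗ K - δ ∗ K²` on all of `ℝ` ("use their right sides to define their left sides for
all real `x`"); `(1 + K̂²)⁻¹ = 1 - Û` (`u ∗ K = K - r/2`, `u ∗ K² = K² - u`) gives `E = ½ AG ∗ r + u ∗ (1_{SΛᶜ} E)`,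
so `|E| ≤ Ŵ|E|` for the operator `Ŵ` of eq. (W) (`liebWuWS`), and `∫ Ŵh ≤ ½ ∫ h` ("`‖Ŵ‖ < 1`") forces `E = 0`
a.e., `δ = 0` a.e., `G ≡ 0`, `AG ≡ 0`, `σ₁ = σ₂` on `SΛ`. No named fact.

## References

* E. H. Lieb, F. Y. Wu, Physica A 321 (2003) 1–27 = arXiv:cond-mat/0207529, §5, Theorem 1 and its
  proof (eqs. (S), (R), (W)) (key `LiebWuPhysicaA2003`); PRL 20 (1968) 1445, statement (a) (`LiebWuPRL1968`).
-/

noncomputable section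

open MeasureTheory Set Real Filter intervalIntegral
open Literature.Analysis.SpecialFunctions
open scoped Convolution

namespace Literature.MathematicalPhysics.QuantumLattice

namespace LiebWuConvS

open LiebWuConv

variable {f f₁ f₂ g g₁ g₂ k : ℝ → ℝ} {B B' : ℝ}

/-- `conv` is Mathlib's convolution for the multiplication pairing. [folklore] -/
private theorem conv_eq_convolution₄ (f g : ℝ → ℝ) :
    conv f g = f ⋆[ContinuousLinearMap.mul ℝ ℝ, volume] g := by
  funext x
  rw [conv, convolution_def]
  simp only [ContinuousLinearMap.mul_apply']

/-- Commutativity. [folklore] -/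
private theorem conv_comm₄ (f g : ℝ → ℝ) (x : ℝ) : conv f g x = conv g f x := by
  rw [conv, conv, ← integral_sub_left_eq_self (fun t => f t * g (x - t)) volume x]
  refine MeasureTheory.integral_congr_ae (Eventually.of_forall fun t => ?_)
  simp only [sub_sub_cancel]
  ring

/-- Integrability of the integrand. [folklore] -/
private theorem integrable_mul_sub₄ (hf : Integrable f) (hgc : Continuous g) (hgB : ∀ y, |g y| ≤ B)
    (x : ℝ) : Integrable fun t => f t * g (x - t) :=
  hf.mul_bdd (hgc.comp (continuous_const.sub continuous_id)).aestronglyMeasurable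
    (Eventually.of_forall fun t => by rw [Real.norm_eq_abs]; exact hgB _)

/-- `conv f g ∈ L¹` for `f, g ∈ L¹`. [folklore] -/
private theorem integrable_conv₄ (hf : Integrable f) (hg : Integrable g) : Integrable (conv f g) := by
  rw [conv_eq_convolution₄]
  exact hf.integrable_convolution _ hg

/-- `conv f g` is continuous for `f ∈ L¹`, `g` bounded continuous. [folklore] -/
private theorem continuous_conv₄ (hf : Integrable f) (hgc : Continuous g) (hgB : ∀ y, |g y| ≤ B) :
    Continuous (conv f g) := by
  rw [conv_eq_convolution₄]
  refine BddAbove.continuous_convolution_right_of_integrable (L := ContinuousLinearMap.mul ℝ ℝ)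
    ⟨B, ?_⟩ hf hgc
  rintro _ ⟨y, rfl⟩
  show ‖g y‖ ≤ B
  rw [Real.norm_eq_abs]
  exact hgB y

/-- Linearity in the first argument. [folklore] -/
private theorem conv_sub_left₄ (hf₁ : Integrable f₁) (hf₂ : Integrable f₂) (hgc : Continuous g)
    (hgB : ∀ y, |g y| ≤ B) (x : ℝ) :
    conv (fun t => f₁ t - f₂ t) g x = conv f₁ g x - conv f₂ g x := by
  rw [conv, conv, conv, ← integral_sub (integrable_mul_sub₄ hf₁ hgc hgB x) (integrable_mul_sub₄ hf₂ hgc hgB x)]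
  refine MeasureTheory.integral_congr_ae (Eventually.of_forall fun t => ?_)
  ring

/-- Linearity in the second argument. [folklore] -/
private theorem conv_sub_right₄ (hf : Integrable f) (hg₁c : Continuous g₁) (hg₁B : ∀ y, |g₁ y| ≤ B)
    (hg₂c : Continuous g₂) (hg₂B : ∀ y, |g₂ y| ≤ B') (x : ℝ) :
    conv f (fun y => g₁ y - g₂ y) x = conv f g₁ x - conv f g₂ x := by
  rw [conv, conv, conv, ← integral_sub (integrable_mul_sub₄ hf hg₁c hg₁B x) (integrable_mul_sub₄ hf hg₂c hg₂B x)]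
  refine MeasureTheory.integral_congr_ae (Eventually.of_forall fun t => ?_)
  ring

/-- Scalars in the second argument. [folklore] -/
private theorem conv_const_mul_right₄ (f g : ℝ → ℝ) (c x : ℝ) :
    conv f (fun y => c * g y) x = c * conv f g x := by
  rw [conv, conv, ← MeasureTheory.integral_const_mul]
  refine MeasureTheory.integral_congr_ae (Eventually.of_forall fun t => ?_)
  ring

/-- `|conv f g| ≤ conv |f| g` for `g ≥ 0`. [folklore] -/
private theorem abs_conv_le_conv_abs₄ (hg0 : ∀ y, 0 ≤ g y) (x : ℝ) :
    |conv f g x| ≤ conv (fun t => |f t|) g x := by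
  calc |conv f g x| ≤ ∫ t, |f t * g (x - t)| := abs_integral_le_integral_abs
    _ = conv (fun t => |f t|) g x := by
        rw [conv]
        refine MeasureTheory.integral_congr_ae (Eventually.of_forall fun t => ?_)
        dsimp only
        rw [abs_mul, abs_of_nonneg (hg0 _)]

/-- Monotonicity in the first argument for `g ≥ 0`. [folklore] -/
private theorem conv_mono_left₄ {x : ℝ} (h : ∀ t, f₁ t ≤ f₂ t) (hg0 : ∀ y, 0 ≤ g y)
    (h₁ : Integrable fun t => f₁ t * g (x - t)) (h₂ : Integrable fun t => f₂ t * g (x - t)) :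
    conv f₁ g x ≤ conv f₂ g x :=
  integral_mono h₁ h₂ fun t => mul_le_mul_of_nonneg_right (h t) (hg0 _)

/-- Associativity `(f ∗ g) ∗ k = f ∗ (g ∗ k)` pointwise. [folklore] -/
private theorem conv_conv₄ (hf : Integrable f) (hgi : Integrable g)
    (hkc : Continuous k) (hkB : ∀ y, |k y| ≤ B') (x : ℝ) :
    conv (conv f g) k x = conv f (conv g k) x := by
  have hprod : Integrable (fun p : ℝ × ℝ => f p.2 * g (p.1 - p.2))
      ((volume : Measure ℝ).prod volume) :=
    hf.convolution_integrand (ContinuousLinearMap.mul ℝ ℝ) hgi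
  have hkm : Continuous fun p : ℝ × ℝ => k (x - p.1) := hkc.comp (continuous_const.sub continuous_fst)
  have h := hprod.mul_bdd (c := B') hkm.aestronglyMeasurable
    (Eventually.of_forall fun p => by rw [Real.norm_eq_abs]; exact hkB _)
  have hF : Integrable (Function.uncurry fun y z => f z * g (y - z) * k (x - y))
      ((volume : Measure ℝ).prod volume) := h
  calc conv (conv f g) k x = ∫ y, (∫ z, f z * g (y - z)) * k (x - y) := rfl
    _ = ∫ y, ∫ z, f z * g (y - z) * k (x - y) := by
        refine MeasureTheory.integral_congr_ae (Eventually.of_forall fun y => ?_)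
        exact (MeasureTheory.integral_mul_const (k (x - y)) _).symm
    _ = ∫ z, ∫ y, f z * g (y - z) * k (x - y) := integral_integral_swap hF
    _ = ∫ z, f z * ∫ s, g s * k (x - z - s) := by
        refine MeasureTheory.integral_congr_ae (Eventually.of_forall fun z => ?_)
        dsimp only
        rw [← MeasureTheory.integral_const_mul,
          ← integral_add_right_eq_self (fun y => f z * g (y - z) * k (x - y)) z]
        refine MeasureTheory.integral_congr_ae (Eventually.of_forall fun s => ?_)
        dsimp only
        rw [add_sub_cancel_right, show x - (s + z) = x - z - s by ring]
        ring
    _ = conv f (conv g k) x := rfl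

end LiebWuConvS

open LiebWuConv LiebWuConvS

section Uniqueness

variable {U Q : ℝ} {SΛ : Set ℝ} {ρ₁ σ₁ ρ₂ σ₂ : ℝ → ℝ}

/-- (13) in convolution form for a general range: `ρ(k) = 1/2π + cos k · ((1_{SΛ}σ) ∗ K_{U/4})(sin k)` on
`[-Q, Q]`. [cite: LiebWuPhysicaA2003, §4, boxed equation for ρ] -/
theorem IsLiebWuDensities.rho_eq_conv_indicator {ρ σ : ℝ → ℝ} (h : IsLiebWuDensities U Q SΛ ρ σ)
    (hS : MeasurableSet SΛ) {k : ℝ} (hk : k ∈ Icc (-Q) Q) :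
    ρ k = 1 / (2 * π) + Real.cos k * conv (SΛ.indicator σ) (cauchyDensity (U / 4)) (Real.sin k) := by
  rw [h.rho_eq hk, conv, ← MeasureTheory.integral_indicator hS]
  congr 2
  refine MeasureTheory.integral_congr_ae (Eventually.of_forall fun t => ?_)
  beta_reduce
  by_cases ht : t ∈ SΛ
  · rw [indicator_of_mem ht, indicator_of_mem ht, mul_comm]
  · rw [indicator_of_notMem ht, indicator_of_notMem ht, zero_mul]

/-- (14) in convolution form for a general range:
`σ(Λ) = ∫_{-Q}^{Q} K_{U/4}(Λ - sin k) ρ(k) dk - ((1_{SΛ}σ) ∗ K_{U/2})(Λ)` for `Λ ∈ SΛ`.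
[cite: LiebWuPhysicaA2003, §4, boxed equation for σ] -/
theorem IsLiebWuDensities.sigma_eq_conv_indicator {ρ σ : ℝ → ℝ} (h : IsLiebWuDensities U Q SΛ ρ σ)
    (hS : MeasurableSet SΛ) {Λ : ℝ} (hΛ : Λ ∈ SΛ) :
    σ Λ = (∫ k in -Q..Q, cauchyDensity (U / 4) (Λ - Real.sin k) * ρ k) -
      conv (SΛ.indicator σ) (cauchyDensity (U / 2)) Λ := by
  rw [h.sigma_eq hΛ, conv, ← MeasureTheory.integral_indicator hS]
  congr 1
  refine MeasureTheory.integral_congr_ae (Eventually.of_forall fun t => ?_)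
  beta_reduce
  by_cases ht : t ∈ SΛ
  · rw [indicator_of_mem ht, indicator_of_mem ht, mul_comm]
  · rw [indicator_of_notMem ht, indicator_of_notMem ht, zero_mul]

/-- **Lieb–Wu 2003, Theorem 1 (uniqueness), every rapidity range: the rapidity density is unique on the
range.** For `U > 0` and a measurable range `SΛ`, two `L¹` solutions of (13)–(14) with the same `(Q, SΛ)`
have the same `σ` at every point of `SΛ`. [cite: LiebWuPhysicaA2003, §5, Theorem 1] -/
theorem IsLiebWuDensities.sigma_unique_on (hU : 0 < U) (hS : MeasurableSet SΛ)
    (h₁ : IsLiebWuDensities U Q SΛ ρ₁ σ₁) (h₂ : IsLiebWuDensities U Q SΛ ρ₂ σ₂) {Λ : ℝ} (hΛ : Λ ∈ SΛ) :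
    σ₁ Λ = σ₂ Λ := by
  have hc : 0 < U / 4 := by positivity
  have h2c : 0 < U / 2 := by positivity
  have hU2 : 2 * (U / 4) = U / 2 := by ring
  -- kernel facts
  have hKB' : ∀ {c : ℝ}, 0 < c → ∀ y, |cauchyDensity c y| ≤ 1 / (π * c) := fun hc y => by
    rw [abs_of_pos (cauchyDensity_pos hc y)]; exact cauchyDensity_le hc y
  have hKc : Continuous (cauchyDensity (U / 4)) := continuous_cauchyDensity hc
  have hKi : Integrable (cauchyDensity (U / 4)) := integrable_cauchyDensity hc.le
  have hKB := hKB' hc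
  have hK0 : ∀ y, 0 ≤ cauchyDensity (U / 4) y := fun y => (cauchyDensity_pos hc y).le
  have hK2c : Continuous (cauchyDensity (U / 2)) := continuous_cauchyDensity h2c
  have hK2i : Integrable (cauchyDensity (U / 2)) := integrable_cauchyDensity h2c.le
  have hK2B := hKB' h2c
  have huc : Continuous (fermiKernel (U / 4)) := continuous_fermiKernel hc
  have hui : Integrable (fermiKernel (U / 4)) := integrable_fermiKernel hc
  have huB : ∀ y, |fermiKernel (U / 4) y| ≤ 1 / (2 * π * (U / 4)) := fun y => by
    rw [abs_of_nonneg (fermiKernel_nonneg hc y)]; exact fermiKernel_le hc y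
  have hu0 : ∀ y, 0 ≤ fermiKernel (U / 4) y := fermiKernel_nonneg hc
  have hrc : Continuous (sechKernel (U / 4)) := continuous_sechKernel hc
  have hrB : ∀ y, |sechKernel (U / 4) y| ≤ 1 / (2 * (U / 4)) := fun y => by
    rw [abs_of_pos (sechKernel_pos hc y)]; exact sechKernel_le hc y
  have hr0 : ∀ y, 0 ≤ sechKernel (U / 4) y := fun y => (sechKernel_pos hc y).le
  have hrB' : ∀ y, |1 / 2 * sechKernel (U / 4) y| ≤ 1 / 2 * (1 / (2 * (U / 4))) := fun y => by
    rw [abs_mul, abs_of_pos (by norm_num : (0:ℝ) < 1 / 2)]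
    exact mul_le_mul_of_nonneg_left (hrB y) (by norm_num)
  -- the two restricted densities and their difference `δ = 1_{SΛ}(σ₁ - σ₂)`
  have hσ₁ : Integrable (SΛ.indicator σ₁) := (integrable_indicator_iff hS).2 h₁.integrableOn_sigma
  have hσ₂ : Integrable (SΛ.indicator σ₂) := (integrable_indicator_iff hS).2 h₂.integrableOn_sigma
  set δ : ℝ → ℝ := fun t => SΛ.indicator σ₁ t - SΛ.indicator σ₂ t with hδ
  have hδi : Integrable δ := hσ₁.sub hσ₂
  have hδ_off : ∀ t, t ∉ SΛ → δ t = 0 := fun t ht => by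
    simp only [hδ, indicator_of_notMem ht, sub_zero]
  have hδ_on : ∀ t, t ∈ SΛ → δ t = σ₁ t - σ₂ t := fun t ht => by
    simp only [hδ, indicator_of_mem ht]
  set G : ℝ → ℝ := conv δ (cauchyDensity (U / 4)) with hG
  have hGc : Continuous G := continuous_conv₄ hδi hKc hKB
  -- (13): `ρ₁ - ρ₂ = cos k · G(sin k)` on `[-Q, Q]`
  have hρ : ∀ k ∈ Icc (-Q) Q, ρ₁ k - ρ₂ k = Real.cos k * G (Real.sin k) := by
    intro k hk
    rw [h₁.rho_eq_conv_indicator hS hk, h₂.rho_eq_conv_indicator hS hk, hG, hδ,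
      conv_sub_left₄ hσ₁ hσ₂ hKc hKB]
    ring
  -- the cutoff `a = sin Q ≥ 0` and the truncated `G`
  have hQ := h₁.cutoff_pos
  set a : ℝ := Real.sin Q with ha
  have ha0 : 0 ≤ a := Real.sin_nonneg_of_nonneg_of_le_pi hQ.le h₁.cutoff_le_pi
  set AG : ℝ → ℝ := (Ioc (-a) a).indicator G with hAG
  have hAGi : Integrable AG := by
    rw [hAG, integrable_indicator_iff measurableSet_Ioc]
    exact (hGc.integrableOn_Icc).mono_set Ioc_subset_Icc_self
  -- (14): the `k`-integrals differ by `AG ∗ K` (substitution `x = sin k`)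
  have hT : ∀ Λ, (∫ k in -Q..Q, cauchyDensity (U / 4) (Λ - Real.sin k) * ρ₁ k) -
      (∫ k in -Q..Q, cauchyDensity (U / 4) (Λ - Real.sin k) * ρ₂ k) =
        conv AG (cauchyDensity (U / 4)) Λ := by
    intro Λ
    have hKs : Continuous fun k => cauchyDensity (U / 4) (Λ - Real.sin k) := by fun_prop
    have hg : Continuous fun x => cauchyDensity (U / 4) (Λ - x) * G x := by fun_prop
    have hsub := intervalIntegral.integral_comp_mul_deriv (a := -Q) (b := Q)
      (fun k _ => Real.hasDerivAt_sin k) Real.continuous_cos.continuousOn hg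
    rw [Real.sin_neg, ← ha] at hsub
    calc (∫ k in -Q..Q, cauchyDensity (U / 4) (Λ - Real.sin k) * ρ₁ k) -
          (∫ k in -Q..Q, cauchyDensity (U / 4) (Λ - Real.sin k) * ρ₂ k)
        = ∫ k in -Q..Q, (cauchyDensity (U / 4) (Λ - Real.sin k) * ρ₁ k -
            cauchyDensity (U / 4) (Λ - Real.sin k) * ρ₂ k) :=
          (intervalIntegral.integral_sub (h₁.intervalIntegrable_rho.continuousOn_mul hKs.continuousOn)
            (h₂.intervalIntegrable_rho.continuousOn_mul hKs.continuousOn)).symm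
      _ = ∫ k in -Q..Q, ((fun x => cauchyDensity (U / 4) (Λ - x) * G x) ∘ Real.sin) k * Real.cos k := by
          refine intervalIntegral.integral_congr fun k hk => ?_
          rw [uIcc_of_le (by linarith)] at hk
          simp only [Function.comp_apply]
          rw [← mul_sub, hρ k hk]
          ring
      _ = ∫ x, (Ioc (-a) a).indicator (fun x => cauchyDensity (U / 4) (Λ - x) * G x) x := by
          rw [hsub, intervalIntegral.integral_of_le (by linarith), MeasureTheory.integral_indicator measurableSet_Ioc]
      _ = conv AG (cauchyDensity (U / 4)) Λ := by
          refine MeasureTheory.integral_congr_ae (Eventually.of_forall fun t => ?_)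
          beta_reduce
          by_cases ht : t ∈ Ioc (-a) a
          · rw [indicator_of_mem ht, hAG, indicator_of_mem ht]; ring
          · rw [indicator_of_notMem ht, hAG, indicator_of_notMem ht, zero_mul]
  -- `E = AG ∗ K - δ ∗ K²` on all of `ℝ`; `δ = E` on the range, `δ = 0` off it
  set E : ℝ → ℝ := fun Λ => conv AG (cauchyDensity (U / 4)) Λ - conv δ (cauchyDensity (U / 2)) Λ with hE
  have hδE : ∀ t, t ∈ SΛ → δ t = E t := by
    intro t ht
    rw [hδ_on t ht, hE]
    dsimp only
    rw [← hT t, h₁.sigma_eq_conv_indicator hS ht, h₂.sigma_eq_conv_indicator hS ht, hδ,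
      conv_sub_left₄ hσ₁ hσ₂ hK2c hK2B]
    ring
  have hEc : Continuous E := (continuous_conv₄ hAGi hKc hKB).sub (continuous_conv₄ hδi hK2c hK2B)
  have hEi : Integrable E := (integrable_conv₄ hAGi hKi).sub (integrable_conv₄ hδi hK2i)
  -- `E - δ = 1_{SΛᶜ} E`
  set EC : ℝ → ℝ := SΛᶜ.indicator E with hEC
  have hEC_eq : ∀ t, E t - δ t = EC t := fun t => by
    by_cases ht : t ∈ SΛ
    · rw [hδE t ht, hEC, indicator_of_notMem (show t ∉ SΛᶜ from fun h' => h' ht), sub_self]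
    · rw [hδ_off t ht, hEC, indicator_of_mem (mem_compl ht), sub_zero]
  have hECi : Integrable EC := hEi.indicator hS.compl
  -- "applying `(1 + K̂²)⁻¹ = 1 - Û`": `E = ½ AG ∗ r + EC ∗ u`
  have hKu : ∀ y, conv (cauchyDensity (U / 4)) (fermiKernel (U / 4)) y =
      cauchyDensity (U / 4) y - 1 / 2 * sechKernel (U / 4) y := fun y => by
    rw [conv_comm₄, conv, integral_fermiKernel_mul_cauchyDensity hc y]; ring
  have hK2u : ∀ y, conv (cauchyDensity (U / 2)) (fermiKernel (U / 4)) y =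
      cauchyDensity (U / 2) y - fermiKernel (U / 4) y := fun y => by
    rw [conv_comm₄, ← hU2]; exact integral_fermiKernel_mul_cauchyDensity_two_mul hc y
  have hEu : ∀ x, E x = 1 / 2 * conv AG (sechKernel (U / 4)) x + conv EC (fermiKernel (U / 4)) x := by
    intro x
    -- `E ∗ u = AG ∗ (K ∗ u) - δ ∗ (K² ∗ u) = (AG ∗ K - ½ AG ∗ r) - (δ ∗ K² - δ ∗ u)`
    have h1 : conv E (fermiKernel (U / 4)) x = conv (conv AG (cauchyDensity (U / 4))) (fermiKernel (U / 4)) x -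
        conv (conv δ (cauchyDensity (U / 2))) (fermiKernel (U / 4)) x := by
      rw [hE]; exact conv_sub_left₄ (integrable_conv₄ hAGi hKi) (integrable_conv₄ hδi hK2i) huc huB x
    have h2 : conv (conv AG (cauchyDensity (U / 4))) (fermiKernel (U / 4)) x =
        conv AG (cauchyDensity (U / 4)) x - 1 / 2 * conv AG (sechKernel (U / 4)) x := by
      rw [conv_conv₄ hAGi hKi huc huB, show conv (cauchyDensity (U / 4)) (fermiKernel (U / 4)) =
        fun y => cauchyDensity (U / 4) y - 1 / 2 * sechKernel (U / 4) y from funext hKu,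
        conv_sub_right₄ hAGi hKc hKB (g₂ := fun y => 1 / 2 * sechKernel (U / 4) y) (continuous_const.mul hrc) hrB',
        conv_const_mul_right₄]
    have h3 : conv (conv δ (cauchyDensity (U / 2))) (fermiKernel (U / 4)) x =
        conv δ (cauchyDensity (U / 2)) x - conv δ (fermiKernel (U / 4)) x := by
      rw [conv_conv₄ hδi hK2i huc huB, show conv (cauchyDensity (U / 2)) (fermiKernel (U / 4)) =
        fun y => cauchyDensity (U / 2) y - fermiKernel (U / 4) y from funext hK2u,
        conv_sub_right₄ hδi hK2c hK2B huc huB]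
    -- `(E - δ) ∗ u = EC ∗ u`
    have h4 : conv E (fermiKernel (U / 4)) x - conv δ (fermiKernel (U / 4)) x = conv EC (fermiKernel (U / 4)) x := by
      rw [← conv_sub_left₄ hEi hδi huc huB]
      exact congrArg (fun f => conv f (fermiKernel (U / 4)) x) (funext hEC_eq)
    have h5 : E x = conv AG (cauchyDensity (U / 4)) x - conv δ (cauchyDensity (U / 2)) x := rfl
    linarith [h1, h2, h3, h4, h5]
  -- domination `|E| ≤ Ŵ|E|` with `Ŵ = liebWuWS U Q SΛ`
  set aE : ℝ → ℝ := fun t => |E t| with haE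
  have haEi : Integrable aE := hEi.abs
  have haE0 : ∀ t, 0 ≤ aE t := fun t => abs_nonneg _
  have hδabs : ∀ t, |δ t| = SΛ.indicator aE t := fun t => by
    by_cases ht : t ∈ SΛ
    · rw [hδE t ht, indicator_of_mem ht]
    · rw [hδ_off t ht, indicator_of_notMem ht, abs_zero]
  have hECabs : ∀ t, |EC t| = SΛᶜ.indicator aE t := fun t => by
    by_cases ht : t ∈ SΛᶜ
    · rw [hEC, indicator_of_mem ht, indicator_of_mem ht]
    · rw [hEC, indicator_of_notMem ht, indicator_of_notMem ht, abs_zero]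
  have hdom : ∀ x, aE x ≤ liebWuWS U Q SΛ aE x := by
    intro x
    -- `|AG| ≤ 1_{(-a,a]} (K ∗ |δ|) = 1_{(-a,a]} ((1_S aE) ∗ K)` pointwise
    have hAGle : ∀ y, |AG y| ≤ (Ioc (-a) a).indicator (fun _ => (1 : ℝ)) y *
        ∫ t, SΛ.indicator aE t * cauchyDensity (U / 4) (y - t) := by
      intro y
      by_cases hy : y ∈ Ioc (-a) a
      · rw [hAG, indicator_of_mem hy, indicator_of_mem hy, one_mul, hG]
        calc |conv δ (cauchyDensity (U / 4)) y| ≤ conv (fun t => |δ t|) (cauchyDensity (U / 4)) y :=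
              abs_conv_le_conv_abs₄ hK0 y
          _ = ∫ t, SΛ.indicator aE t * cauchyDensity (U / 4) (y - t) := by
              rw [conv]
              exact MeasureTheory.integral_congr_ae (Eventually.of_forall fun t => by
                beta_reduce; rw [hδabs t])
      · rw [hAG, indicator_of_notMem hy, indicator_of_notMem hy, abs_zero, zero_mul]
    have hSaEi : Integrable (SΛ.indicator aE) := haEi.indicator hS
    have hF : Integrable fun y => (Ioc (-a) a).indicator (fun _ => (1 : ℝ)) y *
        ∫ t, SΛ.indicator aE t * cauchyDensity (U / 4) (y - t) := by
      have hGi : Integrable (conv (SΛ.indicator aE) (cauchyDensity (U / 4))) := integrable_conv₄ hSaEi hKi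
      exact hGi.bdd_mul (aestronglyMeasurable_const.indicator measurableSet_Ioc)
        (Eventually.of_forall fun y => by
          rw [Real.norm_eq_abs]
          by_cases hy : y ∈ Ioc (-a) a
          · rw [indicator_of_mem hy, abs_one]
          · rw [indicator_of_notMem hy, abs_zero]; exact zero_le_one)
    have h1 : |1 / 2 * conv AG (sechKernel (U / 4)) x| ≤ liebWuW U Q (SΛ.indicator aE) x := by
      rw [abs_mul, abs_of_pos (by norm_num : (0:ℝ) < 1 / 2), liebWuW, ← ha]
      refine mul_le_mul_of_nonneg_left ((abs_conv_le_conv_abs₄ hr0 x).trans ?_) (by norm_num)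
      exact conv_mono_left₄ hAGle hr0 (integrable_mul_sub₄ hAGi.abs hrc hrB x) (integrable_mul_sub₄ hF hrc hrB x)
    have h2 : |conv EC (fermiKernel (U / 4)) x| ≤ ∫ t, SΛᶜ.indicator aE t * fermiKernel (U / 4) (x - t) := by
      refine (abs_conv_le_conv_abs₄ hu0 x).trans_eq ?_
      rw [conv]
      exact MeasureTheory.integral_congr_ae (Eventually.of_forall fun t => by beta_reduce; rw [hECabs t])
    calc aE x = |E x| := rfl
      _ = |1 / 2 * conv AG (sechKernel (U / 4)) x + conv EC (fermiKernel (U / 4)) x| := by rw [hEu x]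
      _ ≤ |1 / 2 * conv AG (sechKernel (U / 4)) x| + |conv EC (fermiKernel (U / 4)) x| := abs_add_le _ _
      _ ≤ liebWuWS U Q SΛ aE x := by rw [liebWuWS]; exact add_le_add h1 h2
  -- "`‖Ŵ‖ < 1`": `∫ |E| ≤ ∫ Ŵ|E| ≤ ½ ∫ |E|`, so `E = 0` a.e.
  obtain ⟨_, _, hWi, hWint, _⟩ := liebWuWS_props (Q := Q) hU hS haEi haE0
  have hint0 : ∫ x, aE x = 0 := by
    have h1 : ∫ x, aE x ≤ ∫ x, liebWuWS U Q SΛ aE x := integral_mono haEi hWi hdom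
    have h2 : 0 ≤ ∫ x, aE x := integral_nonneg haE0
    linarith
  have haE_ae : aE =ᵐ[volume] 0 := (integral_eq_zero_iff_of_nonneg haE0 haEi).1 hint0
  have hδ0 : δ =ᵐ[volume] 0 := by
    filter_upwards [haE_ae] with t ht
    have h := hδabs t
    by_cases hts : t ∈ SΛ
    · rw [indicator_of_mem hts, ht] at h
      exact abs_eq_zero.1 h
    · exact hδ_off t hts
  -- `G ≡ 0`, hence `AG ≡ 0`, hence `δ = E = 0` on the range
  have hconv0 : ∀ (g : ℝ → ℝ) (y : ℝ), conv δ g y = 0 := by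
    intro g y
    rw [conv, MeasureTheory.integral_congr_ae (g := fun _ => (0 : ℝ)) ?_, MeasureTheory.integral_zero]
    filter_upwards [hδ0] with t ht
    rw [ht, Pi.zero_apply, zero_mul]
  have hAG0 : AG = fun _ => 0 := by
    funext y
    by_cases hy : y ∈ Ioc (-a) a
    · rw [hAG, indicator_of_mem hy, hG, hconv0]
    · rw [hAG, indicator_of_notMem hy]
  have h := hδE Λ hΛ
  rw [hδ_on Λ hΛ] at h
  have h' : σ₁ Λ - σ₂ Λ = conv AG (cauchyDensity (U / 4)) Λ - conv δ (cauchyDensity (U / 2)) Λ := h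
  rw [hconv0, hAG0, conv] at h'
  simp only [zero_mul, MeasureTheory.integral_zero, sub_zero] at h'
  exact sub_eq_zero.mp h'

end Uniqueness

end Literature.MathematicalPhysics.QuantumLattice

end
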